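import Summits.BirchSwinnertonDyer.BirchSwinnertonDyer.Theorems.AlignedTransportAtTwoMainConjectureOfRankZeroBSDAtTwoFineRoadArchNetting
import Literature.NumberTheory.EllipticCurves.KatoFineSelmerDualRelaxedAtInfinity
import HarnessLib

/-!
# Route `AlignedTransportAtTwo`, crux C2 `MainConjectureOfRankZeroBSDAtTwo` (stmt-BirchSwinnertonDyer-22298):
# the netted road (b″) against the RELAXED-AT-∞ fine dual — glue K₂ⁿᵉᵗʳ ⟹ MuIneqʳ for skeleton v6

HONEST FRAMING (cell `bsd-f1-sign2`, WIDTH-5 attached prover seat `bsd-line-att-p3` gen 3, line `birth` of the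
lead `bsd-line-att-p2`; BSD is NOT proved by any of this). THEOREMS ONLY; nothing asserted. Skeleton v6 of the line
(lead att-p2 g3, 405a1387) registers road (b″) NETTED AT INFINITY with stubs Limʳ (`ClassicalMuVanishes` of
`F = ℚ(W[2], ζ₄)` ⟹ `ℓ₍₂₎(X₀^{rel∞}(W/ℚ_∞)) = 0`), MuIneqʳ (`ℓ₍₂₎(X(W/ℚ_∞)) ≤ ℓ₍₂₎(Λ/(G₊)) + ℓ₍₂₎(X₀^{rel∞}(W/ℚ_∞))`
for every `D : SelmerDualData`, `Yr : FineSelmerDualDataRelaxedInf` — the typer's receptacle p600292) and PFμ⁺. This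
file is the lead's requested glue «KatoDataʳ ⟹ MuIneqʳ» (bus 03:18:53Z): the DISPLAYED netted data (Kato's row over
`ℚ(ζ_{2^∞})` with `Δ`-action, injective `Δ`-equivariant Coleman map with finite cokernel, zeta images with
`a + b = 2^e·s·G₊`, relaxed descent `fd : X'_Δ → X^{rel}` with finite cokernel, archimedean extension
`q : X^{rel} ↠ X(W/ℚ_∞)` with `e ≤ ℓ₍₂₎(ker q)`, and a fine comparison `fyʳ : X₀(W/K_∞)_Δ → X₀^{rel∞}(W/ℚ_∞)` with
`ℓ₍₂₎(ker fyʳ) = 0` — inf–res, no archimedean term for either sign since the target is relaxed at `∞`, REF1 §62 (ii))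
imply the registered inequality VERBATIM, via `…FineRoadArchNetting.lengthAt_le_of_coinvDatum_netting`.

* §1 `selmerDual_lengthAt_le_of_roadB2_netting_rel_two` — per cyclotomic datum: the inequality for the pair
  `(D.X, Yr.X)` from the netted data.
* §2 `muInequalityRelAtTwo_of_katoNetDataRel` — K₂ⁿᵉᵗʳ ⟹ MuIneqʳ (conclusion = the registered stub's body verbatim).
* §3 `seedMuZeroAtTwo_of_fineRoadNettingRel` / `mainConjectureOfRankZeroBSDAtTwo_of_fineRoadNettingRel` — stub T and
  C2 BY NAME from P (modularity) + Limʳ + K₂ⁿᵉᵗʳ + PFμ⁺ (bodies verbatim from skeleton v6). CONDITIONAL: the item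
  stays open (PFμ⁺ = Iwasawa's `μ₂ = 0` for `ℚ(W[2], ζ₄)`, OPEN for `S₃` image; K₂ⁿᵉᵗʳ and Limʳ await typing). As for
  every `∃`-over-Types data shape, the displayed data certify no provenance (att-p3 g2 `…CoinvDataJunk`).

References: K. Kato, Astérisque 295 (2004), Thm. 17.4 (1), Prop. 17.11, §17.13; R. Greenberg, LNM 1716 (1999), Lemma
4.6 and pp. 98–99; J. Coates, R. Sujatha, Math. Ann. 331 (2005) §3, Thm. 3.4; M. F. Lim, Asian J. Math. 21 (2017)
Thm. 3.5.
-/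

set_option linter.dupNamespace false
set_option autoImplicit false

noncomputable section

open scoped Classical

open Literature.NumberTheory.EllipticCurves Literature.NumberTheory.EllipticCurves.Module

namespace Summit.BirchSwinnertonDyer.BirchSwinnertonDyer.Theorems.AlignedTransportAtTwoFineRoad

/-! ## §1 Per cyclotomic datum: the netted inequality against the relaxed fine dual -/

section AtTwo

open WeierstrassCurve Summit.BirchSwinnertonDyer.Rank1Residual.X1.MuLambda

variable (W : WeierstrassCurve ℚ) {κ : ZpExtension ℚ 2} {γ : Field.absoluteGaloisGroup ℚ}

/-- **The netted `μ`-inequality against the relaxed fine dual, per cyclotomic datum.** For `D` (dual of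
`Sel_{2^∞}(E/ℚ_∞)`) and `Yr` (dual of `Sel₀^{rel∞}(E/ℚ_∞)`, -ty p600292) and the DISPLAYED netted data (road-(b″)
row over `ℚ(ζ_{2^∞})` with `Δ`-action, Coleman map with finite cokernel, zeta images with `a + b = 2^e·s·G`, relaxed
descent `fd` with finite cokernel, archimedean extension `q : X^{rel} ↠ D.X` with `e ≤ ℓ₍₂₎(ker q)`, fine comparison
`fyʳ : Y'_Δ → Yr.X` with `ℓ₍₂₎(ker fyʳ) = 0`): `ℓ₍₂₎(D.X) ≤ ℓ₍₂₎(Λ/(G)) + ℓ₍₂₎(Yr.X)`.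
[cite: Kato2004Asterisque, Prop. 17.11 (p. 277) and §17.13 (pp. 279–280)] [cite: GreenbergLNM1716, Lemma 4.6 and pp. 98–99] -/
theorem selmerDual_lengthAt_le_of_roadB2_netting_rel_two (D : W.SelmerDualData κ γ)
    (Yr : W.FineSelmerDualDataRelaxedInf κ γ) {G : IwasawaAlgebra 2}
    {P X' Y' Xr : Type*} [AddCommGroup P] [_root_.Module (IwasawaAlgebra 2) P]
    [AddCommGroup X'] [_root_.Module (IwasawaAlgebra 2) X']
    [AddCommGroup Y'] [_root_.Module (IwasawaAlgebra 2) Y']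
    [AddCommGroup Xr] [_root_.Module (IwasawaAlgebra 2) Xr]
    (toX : P →ₗ[IwasawaAlgebra 2] X') (π : X' →ₗ[IwasawaAlgebra 2] Y') (hX : Function.Exact toX π)
    (hπ : Function.Surjective π) (cP : P →ₗ[IwasawaAlgebra 2] P) (cX : X' →ₗ[IwasawaAlgebra 2] X')
    (cY : Y' →ₗ[IwasawaAlgebra 2] Y') (hcX : toX ∘ₗ cP = cX ∘ₗ toX) (hcY : π ∘ₗ cX = cY ∘ₗ π)
    (col : P →ₗ[IwasawaAlgebra 2] IwasawaAlgebra 2 × IwasawaAlgebra 2) (hcol : Function.Injective col)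
    (hccol : col ∘ₗ cP = (LinearEquiv.prodComm (IwasawaAlgebra 2) (IwasawaAlgebra 2) (IwasawaAlgebra 2) :
      IwasawaAlgebra 2 × IwasawaAlgebra 2 →ₗ[IwasawaAlgebra 2] IwasawaAlgebra 2 × IwasawaAlgebra 2) ∘ₗ col)
    (hfin : Finite ((IwasawaAlgebra 2 × IwasawaAlgebra 2) ⧸ LinearMap.range col))
    {w₁ w₂ : P} (h₁ : toX w₁ = 0) (h₂ : toX w₂ = 0) {a b s : IwasawaAlgebra 2} {e : ℕ} (hw₁ : col w₁ = (a, b))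
    (hw₂ : col w₂ = (b, a)) (hs : s ∉ IwasawaAlgebra.augIdealP 2)
    (hab : a + b = PowerSeries.C ((2 : ℤ_[2]) ^ e) * s * G)
    (fd : (X' ⧸ LinearMap.range (cX - 1)) →ₗ[IwasawaAlgebra 2] Xr) (hfd : Finite (Xr ⧸ LinearMap.range fd))
    (q : Xr →ₗ[IwasawaAlgebra 2] D.X) (hq : Function.Surjective q)
    (he : (e : ℕ∞) ≤ lengthAt (IwasawaAlgebra 2) (LinearMap.ker q)
      ⟨IwasawaAlgebra.augIdealP 2, IwasawaAlgebra.isPrime_augIdealP_holds 2⟩)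
    (fyr : (Y' ⧸ LinearMap.range (cY - 1)) →ₗ[IwasawaAlgebra 2] Yr.X)
    (hfyr : lengthAt (IwasawaAlgebra 2) (LinearMap.ker fyr)
      ⟨IwasawaAlgebra.augIdealP 2, IwasawaAlgebra.isPrime_augIdealP_holds 2⟩ = 0) :
    lengthAt (IwasawaAlgebra 2) D.X ⟨IwasawaAlgebra.augIdealP 2, IwasawaAlgebra.isPrime_augIdealP_holds 2⟩ ≤
      lengthAt (IwasawaAlgebra 2) (IwasawaAlgebra 2 ⧸ Ideal.span {G})
          ⟨IwasawaAlgebra.augIdealP 2, IwasawaAlgebra.isPrime_augIdealP_holds 2⟩ +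
        lengthAt (IwasawaAlgebra 2) Yr.X ⟨IwasawaAlgebra.augIdealP 2, IwasawaAlgebra.isPrime_augIdealP_holds 2⟩ := by
  let 𝔭 : PrimeSpectrum (IwasawaAlgebra 2) :=
    ⟨IwasawaAlgebra.augIdealP 2, IwasawaAlgebra.isPrime_augIdealP_holds 2⟩
  have h := lengthAt_le_of_coinvDatum_netting 2 𝔭 rfl toX π hX hπ cP cX cY hcX hcY col hcol hccol hfin h₁ h₂
    hw₁ hw₂ hs (by exact_mod_cast hab) fd hfd q hq he
  have hfyr' : lengthAt (IwasawaAlgebra 2) (LinearMap.ker fyr) 𝔭 = 0 := hfyr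
  have hY : lengthAt (IwasawaAlgebra 2) (Y' ⧸ LinearMap.range (cY - 1)) 𝔭 ≤
      lengthAt (IwasawaAlgebra 2) Yr.X 𝔭 := by
    have h' := lengthAt_le_ker_add fyr 𝔭
    rwa [hfyr', zero_add] at h'
  exact h.trans (by gcongr)

end AtTwo

/-! ## §2 K₂ⁿᵉᵗʳ ⟹ MuIneqʳ (the registered stub of skeleton v6, verbatim) -/

section Glue

open CongruenceSubgroup WeierstrassCurve Literature.NumberTheory.EllipticCurves.ModularForms
  Literature.NumberTheory.EllipticCurves.Greenberg1999
  Literature.NumberTheory.EllipticCurves.Rank1Residual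
  Literature.NumberTheory.IwasawaTheory
  Summit.BirchSwinnertonDyer.Rank1Residual Summit.BirchSwinnertonDyer.Rank1Residual.X1.MuLambda
  Summit.BirchSwinnertonDyer.Rank1Residual.X5 Summit.BirchSwinnertonDyer.Rank1Residual.F1Sign2
  Summit.BirchSwinnertonDyer.BirchSwinnertonDyer.Theorems.Rank1ResidualX1Defs
  Summit.BirchSwinnertonDyer.BirchSwinnertonDyer.Theses.AlignedTransportAtTwo

/-- **K₂ⁿᵉᵗʳ ⟹ MuIneqʳ.** The DISPLAYED netted road-(b″) data against the relaxed-at-∞ fine dual (for every `W`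
good ordinary at `2` without rational `2`-torsion, every cyclotomic datum, newform `f`, integral lift `G₊` of
`L₂(f, α)`, `D : SelmerDualData`, `Yr : FineSelmerDualDataRelaxedInf`: Kato's row over `ℚ(ζ_{2^∞})` with `Δ`-action,
injective `Δ`-equivariant Coleman map with finite cokernel, zeta images with `a + b = 2^e·s·G₊` for SOME `e`, relaxed
descent `fd` with finite cokernel, archimedean extension `q` with `e ≤ ℓ₍₂₎(ker q)`, fine comparison `fyʳ` with
`ℓ₍₂₎(ker fyʳ) = 0`; nothing asserted) imply skeleton v6's registered stub `MuInequalityRelAtTwo` VERBATIM.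
[cite: Kato2004Asterisque, Thm. 17.4 (1) (p. 273), Prop. 17.11 (p. 277), §17.13 (pp. 279–280)]
[cite: GreenbergLNM1716, Lemma 4.6 and pp. 98–99] -/
theorem muInequalityRelAtTwo_of_katoNetDataRel
    (hK2nr : ∀ (W : WeierstrassCurve ℚ) [W.IsElliptic] [W.IsGloballyMinimal], IsOrdinaryAt W 2 →
      (∀ x : ℚ, ¬ HasRationalTwoTorsionX W x) →
      ∀ (κ : ZpExtension ℚ 2) (γ : Field.absoluteGaloisGroup ℚ), κ.IsCyclotomic →
      κ.IsTopGenerator γ → IsCyclotomicVariable 2 γ →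
      ∀ ⦃N : ℕ⦄ [NeZero N] (f : CuspForm (Gamma0 N) 2), IsNewformOf W f →
      ∀ Gp : IwasawaAlgebra 2, iwasawaToPowerSeries 2 Gp = padicLFunction f (unitRoot W 2 : ℚ_[2]) →
      ∀ (D : W.SelmerDualData κ γ) (Yr : W.FineSelmerDualDataRelaxedInf κ γ),
        ∃ (P X' Y' Xr : Type) (_ : AddCommGroup P) (_ : _root_.Module (IwasawaAlgebra 2) P)
          (_ : AddCommGroup X') (_ : _root_.Module (IwasawaAlgebra 2) X')
          (_ : AddCommGroup Y') (_ : _root_.Module (IwasawaAlgebra 2) Y')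
          (_ : AddCommGroup Xr) (_ : _root_.Module (IwasawaAlgebra 2) Xr)
          (toX : P →ₗ[IwasawaAlgebra 2] X') (π : X' →ₗ[IwasawaAlgebra 2] Y')
          (cP : P →ₗ[IwasawaAlgebra 2] P) (cX : X' →ₗ[IwasawaAlgebra 2] X')
          (cY : Y' →ₗ[IwasawaAlgebra 2] Y')
          (col : P →ₗ[IwasawaAlgebra 2] IwasawaAlgebra 2 × IwasawaAlgebra 2) (w₁ w₂ : P)
          (a b s : IwasawaAlgebra 2) (e : ℕ) (fd : (X' ⧸ LinearMap.range (cX - 1)) →ₗ[IwasawaAlgebra 2] Xr)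
          (q : Xr →ₗ[IwasawaAlgebra 2] D.X)
          (fyr : (Y' ⧸ LinearMap.range (cY - 1)) →ₗ[IwasawaAlgebra 2] Yr.X),
          Function.Exact toX π ∧ Function.Surjective π ∧ toX ∘ₗ cP = cX ∘ₗ toX ∧ π ∘ₗ cX = cY ∘ₗ π ∧
          Function.Injective col ∧
          col ∘ₗ cP = (LinearEquiv.prodComm (IwasawaAlgebra 2) (IwasawaAlgebra 2) (IwasawaAlgebra 2) :
            IwasawaAlgebra 2 × IwasawaAlgebra 2 →ₗ[IwasawaAlgebra 2]
              IwasawaAlgebra 2 × IwasawaAlgebra 2) ∘ₗ col ∧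
          Finite ((IwasawaAlgebra 2 × IwasawaAlgebra 2) ⧸ LinearMap.range col) ∧
          toX w₁ = 0 ∧ toX w₂ = 0 ∧ col w₁ = (a, b) ∧ col w₂ = (b, a) ∧
          s ∉ IwasawaAlgebra.augIdealP 2 ∧ a + b = PowerSeries.C ((2 : ℤ_[2]) ^ e) * s * Gp ∧
          Finite (Xr ⧸ LinearMap.range fd) ∧ Function.Surjective q ∧
          (e : ℕ∞) ≤ lengthAt (IwasawaAlgebra 2) (LinearMap.ker q)
              ⟨IwasawaAlgebra.augIdealP 2, IwasawaAlgebra.isPrime_augIdealP_holds 2⟩ ∧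
          lengthAt (IwasawaAlgebra 2) (LinearMap.ker fyr)
              ⟨IwasawaAlgebra.augIdealP 2, IwasawaAlgebra.isPrime_augIdealP_holds 2⟩ = 0) :
    ∀ (W : WeierstrassCurve ℚ) [W.IsElliptic] [W.IsGloballyMinimal], IsOrdinaryAt W 2 →
      (∀ x : ℚ, ¬ HasRationalTwoTorsionX W x) →
      ∀ (κ : ZpExtension ℚ 2) (γ : Field.absoluteGaloisGroup ℚ), κ.IsCyclotomic →
      κ.IsTopGenerator γ → IsCyclotomicVariable 2 γ →
      ∀ ⦃N : ℕ⦄ [NeZero N] (f : CuspForm (Gamma0 N) 2), IsNewformOf W f →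
      ∀ Gp : IwasawaAlgebra 2, iwasawaToPowerSeries 2 Gp = padicLFunction f (unitRoot W 2 : ℚ_[2]) →
      ∀ (D : W.SelmerDualData κ γ) (Yr : W.FineSelmerDualDataRelaxedInf κ γ),
        Literature.NumberTheory.EllipticCurves.Module.lengthAt (IwasawaAlgebra 2) D.X
            ⟨IwasawaAlgebra.augIdealP 2, IwasawaAlgebra.isPrime_augIdealP_holds 2⟩ ≤
          Literature.NumberTheory.EllipticCurves.Module.lengthAt (IwasawaAlgebra 2)
              (IwasawaAlgebra 2 ⧸ Ideal.span {Gp})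
              ⟨IwasawaAlgebra.augIdealP 2, IwasawaAlgebra.isPrime_augIdealP_holds 2⟩ +
            Literature.NumberTheory.EllipticCurves.Module.lengthAt (IwasawaAlgebra 2) Yr.X
              ⟨IwasawaAlgebra.augIdealP 2, IwasawaAlgebra.isPrime_augIdealP_holds 2⟩ := by
  intro W _ _ hord ht κ γ hκ hγ hγ' N _ f hf Gp hGp D Yr
  obtain ⟨P, X', Y', Xr, _, _, _, _, _, _, _, _, toX, π, cP, cX, cY, col, w₁, w₂, a, b, s, e, fd, q, fyr, hX, hπ,
    hcX, hcY, hcol, hccol, hfin, h₁, h₂, hw₁, hw₂, hs, hab, hfd, hq, he, hfyr⟩ :=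
    hK2nr W hord ht κ γ hκ hγ hγ' f hf Gp hGp D Yr
  exact selmerDual_lengthAt_le_of_roadB2_netting_rel_two W D Yr toX π hX hπ cP cX cY hcX hcY col hcol hccol hfin
    h₁ h₂ hw₁ hw₂ hs hab fd hfd q hq he fyr hfyr

/-! ## §3 Stub T and the crux on the netted road of skeleton v6 -/

/-- **Stub T of line `birth` (skeleton v6) on the netted road (b″): P (modularity) + Limʳ + K₂ⁿᵉᵗʳ + PFμ⁺ ⟹
`SeedMuZeroAtTwo`** — the skeleton's `roadB2rel_glue` with the registered MuIneqʳ supplied from the displayed netted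
data by `muInequalityRelAtTwo_of_katoNetDataRel` (bodies of Limʳ / PFμ⁺ / T verbatim from v6). The crux's even-branch
binder `red G₊ ≠ 0` is load-bearing. [cite: Kato2004Asterisque, Thm. 17.4 (1), Prop. 17.11, §17.13 (pp. 273–280)]
[cite: GreenbergLNM1716, Lemma 4.6 and pp. 98–99] [cite: CoatesSujatha2005, statement (A) (§3) and Thm. 3.4] -/
theorem seedMuZeroAtTwo_of_fineRoadNettingRel (hmod : nonempty_modularParametrizationData)
    (hLr : ∀ (W : WeierstrassCurve ℚ) [W.IsElliptic] [W.IsGloballyMinimal], IsOrdinaryAt W 2 →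
      (∀ x : ℚ, ¬ HasRationalTwoTorsionX W x) →
      ∀ i : AlgebraicClosure ℚ, i ^ 2 = -1 →
      (∀ κL : ZpExtension ↥(W.divisionField 2 ⊔ IntermediateField.adjoin ℚ {i}) 2,
        κL.IsCyclotomic → ClassicalMuVanishes κL) →
      ∀ (κ : ZpExtension ℚ 2) (γ : Field.absoluteGaloisGroup ℚ), κ.IsCyclotomic →
      κ.IsTopGenerator γ → IsCyclotomicVariable 2 γ →
      ∀ Yr : W.FineSelmerDualDataRelaxedInf κ γ,
        Literature.NumberTheory.EllipticCurves.Module.lengthAt (IwasawaAlgebra 2) Yr.X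
            ⟨IwasawaAlgebra.augIdealP 2, IwasawaAlgebra.isPrime_augIdealP_holds 2⟩ = 0)
    (hK2nr : ∀ (W : WeierstrassCurve ℚ) [W.IsElliptic] [W.IsGloballyMinimal], IsOrdinaryAt W 2 →
      (∀ x : ℚ, ¬ HasRationalTwoTorsionX W x) →
      ∀ (κ : ZpExtension ℚ 2) (γ : Field.absoluteGaloisGroup ℚ), κ.IsCyclotomic →
      κ.IsTopGenerator γ → IsCyclotomicVariable 2 γ →
      ∀ ⦃N : ℕ⦄ [NeZero N] (f : CuspForm (Gamma0 N) 2), IsNewformOf W f →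
      ∀ Gp : IwasawaAlgebra 2, iwasawaToPowerSeries 2 Gp = padicLFunction f (unitRoot W 2 : ℚ_[2]) →
      ∀ (D : W.SelmerDualData κ γ) (Yr : W.FineSelmerDualDataRelaxedInf κ γ),
        ∃ (P X' Y' Xr : Type) (_ : AddCommGroup P) (_ : _root_.Module (IwasawaAlgebra 2) P)
          (_ : AddCommGroup X') (_ : _root_.Module (IwasawaAlgebra 2) X')
          (_ : AddCommGroup Y') (_ : _root_.Module (IwasawaAlgebra 2) Y')
          (_ : AddCommGroup Xr) (_ : _root_.Module (IwasawaAlgebra 2) Xr)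
          (toX : P →ₗ[IwasawaAlgebra 2] X') (π : X' →ₗ[IwasawaAlgebra 2] Y')
          (cP : P →ₗ[IwasawaAlgebra 2] P) (cX : X' →ₗ[IwasawaAlgebra 2] X')
          (cY : Y' →ₗ[IwasawaAlgebra 2] Y')
          (col : P →ₗ[IwasawaAlgebra 2] IwasawaAlgebra 2 × IwasawaAlgebra 2) (w₁ w₂ : P)
          (a b s : IwasawaAlgebra 2) (e : ℕ) (fd : (X' ⧸ LinearMap.range (cX - 1)) →ₗ[IwasawaAlgebra 2] Xr)
          (q : Xr →ₗ[IwasawaAlgebra 2] D.X)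
          (fyr : (Y' ⧸ LinearMap.range (cY - 1)) →ₗ[IwasawaAlgebra 2] Yr.X),
          Function.Exact toX π ∧ Function.Surjective π ∧ toX ∘ₗ cP = cX ∘ₗ toX ∧ π ∘ₗ cX = cY ∘ₗ π ∧
          Function.Injective col ∧
          col ∘ₗ cP = (LinearEquiv.prodComm (IwasawaAlgebra 2) (IwasawaAlgebra 2) (IwasawaAlgebra 2) :
            IwasawaAlgebra 2 × IwasawaAlgebra 2 →ₗ[IwasawaAlgebra 2]
              IwasawaAlgebra 2 × IwasawaAlgebra 2) ∘ₗ col ∧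
          Finite ((IwasawaAlgebra 2 × IwasawaAlgebra 2) ⧸ LinearMap.range col) ∧
          toX w₁ = 0 ∧ toX w₂ = 0 ∧ col w₁ = (a, b) ∧ col w₂ = (b, a) ∧
          s ∉ IwasawaAlgebra.augIdealP 2 ∧ a + b = PowerSeries.C ((2 : ℤ_[2]) ^ e) * s * Gp ∧
          Finite (Xr ⧸ LinearMap.range fd) ∧ Function.Surjective q ∧
          (e : ℕ∞) ≤ lengthAt (IwasawaAlgebra 2) (LinearMap.ker q)
              ⟨IwasawaAlgebra.augIdealP 2, IwasawaAlgebra.isPrime_augIdealP_holds 2⟩ ∧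
          lengthAt (IwasawaAlgebra 2) (LinearMap.ker fyr)
              ⟨IwasawaAlgebra.augIdealP 2, IwasawaAlgebra.isPrime_augIdealP_holds 2⟩ = 0)
    (hμ : ∀ (W : WeierstrassCurve ℚ) [W.IsElliptic] [W.IsGloballyMinimal], ¬ W.HasCM →
      IsOrdinaryAt W 2 → (∀ x : ℚ, ¬ HasRationalTwoTorsionX W x) → ¬ IsSquare W.Δ →
      W.analyticRank = 0 → BSDp W 2 →
      ∀ i : AlgebraicClosure ℚ, i ^ 2 = -1 →
      ∀ κL : ZpExtension ↥(W.divisionField 2 ⊔ IntermediateField.adjoin ℚ {i}) 2,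
        κL.IsCyclotomic → ClassicalMuVanishes κL) :
    ∀ (W : WeierstrassCurve ℚ) [W.IsElliptic] [W.IsGloballyMinimal], ¬ W.HasCM →
      IsOrdinaryAt W 2 → (∀ x : ℚ, ¬ HasRationalTwoTorsionX W x) → ¬ IsSquare W.Δ →
      W.analyticRank = 0 →
      (∀ ⦃N : ℕ⦄ [NeZero N] (f : CuspForm (Gamma0 N) 2), IsNewformOf W f →
        ∀ G : IwasawaAlgebra 2, IsEvenBranchLiftAtTwo W f G → red G ≠ 0) →
      BSDp W 2 →
      ∀ (κ : ZpExtension ℚ 2) (γ : Field.absoluteGaloisGroup ℚ), κ.IsCyclotomic →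
        κ.IsTopGenerator γ → IsCyclotomicVariable 2 γ →
        ∀ D : W.SelmerDualData κ γ, D.IsTorsion → D.mu = 0 := by
  intro W _ _ hcm hord ht hsq hr hμan hbsd κ γ hκ hγ hγ' D _
  let 𝔭 : PrimeSpectrum (IwasawaAlgebra 2) :=
    ⟨IwasawaAlgebra.augIdealP 2, IwasawaAlgebra.isPrime_augIdealP_holds 2⟩
  have hirr : Irr W 2 := AlignedTransportAtTwoSeed.irr_two_of_forall_not_hasRationalTwoTorsionX W ht
  haveI : NeZero (W.conductorNorm ℤ) := ⟨(W.conductorNorm_pos_holds).ne'⟩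
  obtain ⟨Dm⟩ := hmod W
  obtain ⟨Gp, hGp⟩ := exists_iwasawaToPowerSeries_eq_padicLFunction_two hord Dm.isNewformOf hirr
  have hred : red Gp ≠ 0 := hμan Dm.f Dm.isNewformOf Gp (Or.inl ⟨hord, hGp⟩)
  let Yr : W.FineSelmerDualDataRelaxedInf κ γ := W.fineSelmerDualDataRelaxedInf κ hγ
  obtain ⟨i, hi⟩ : ∃ i : AlgebraicClosure ℚ, i ^ 2 = -1 := IsAlgClosed.exists_pow_nat_eq (-1) (by norm_num)
  have hY : lengthAt (IwasawaAlgebra 2) Yr.X 𝔭 = 0 :=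
    hLr W hord ht i hi (hμ W hcm hord ht hsq hr hbsd i hi) κ γ hκ hγ hγ' Yr
  have hle := muInequalityRelAtTwo_of_katoNetDataRel hK2nr W hord ht κ γ hκ hγ hγ' Dm.f Dm.isNewformOf Gp hGp D Yr
  have hX0 : lengthAt (IwasawaAlgebra 2) D.X 𝔭 = 0 := lengthAt_eq_zero_of_muInequality 2 𝔭 rfl hred hY hle
  change muInvariant 2 D.X = 0
  rw [muInvariant_eq_toNat_lengthAt 2 D.X 𝔭 rfl, hX0]
  rfl

/-- **C2 BY NAME on the netted road (b″) of skeleton v6.** PRINT {Kato 17.4 (1)(2) at `2`, Greenberg 4.1, period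
unit, modularity, GZK} + Limʳ + K₂ⁿᵉᵗʳ + PFμ⁺ ⟹ `MainConjectureOfRankZeroBSDAtTwo`. CONDITIONAL: the item stays open
(PFμ⁺ OPEN class-wide for `S₃` image; Limʳ, K₂ⁿᵉᵗʳ await typing). [cite: Kato2004Asterisque, Thm. 17.4 (p. 273) and §17.13 (pp. 279–280)]
[cite: GreenbergLNM1716, Thm. 4.1 (p. 102), Lemma 4.6 and Conj. 1.11 (p. 58)] [cite: CoatesSujatha2005, Thm. 3.4] -/
theorem mainConjectureOfRankZeroBSDAtTwo_of_fineRoadNettingRel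
    (h17 : ∀ (V : WeierstrassCurve ℚ) [V.IsElliptic] [V.IsGloballyMinimal] [NeZero (V.conductorNorm ℤ)]
      (f : CuspForm (Gamma0 (V.conductorNorm ℤ)) 2), kato_divisibility_allPrimes V 2 (f := f))
    (hGr : Greenberg1999.thm41_charValue_rankZero_anyPrime)
    (hper : realPeriodRat_eq_unit_mul_plusPeriod_two) (hmod : nonempty_modularParametrizationData)
    (hGZK : rank_eq_analyticRank_of_analyticRank_le_one)
    (hLr : ∀ (W : WeierstrassCurve ℚ) [W.IsElliptic] [W.IsGloballyMinimal], IsOrdinaryAt W 2 →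
      (∀ x : ℚ, ¬ HasRationalTwoTorsionX W x) →
      ∀ i : AlgebraicClosure ℚ, i ^ 2 = -1 →
      (∀ κL : ZpExtension ↥(W.divisionField 2 ⊔ IntermediateField.adjoin ℚ {i}) 2,
        κL.IsCyclotomic → ClassicalMuVanishes κL) →
      ∀ (κ : ZpExtension ℚ 2) (γ : Field.absoluteGaloisGroup ℚ), κ.IsCyclotomic →
      κ.IsTopGenerator γ → IsCyclotomicVariable 2 γ →
      ∀ Yr : W.FineSelmerDualDataRelaxedInf κ γ,
        Literature.NumberTheory.EllipticCurves.Module.lengthAt (IwasawaAlgebra 2) Yr.X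
            ⟨IwasawaAlgebra.augIdealP 2, IwasawaAlgebra.isPrime_augIdealP_holds 2⟩ = 0)
    (hK2nr : ∀ (W : WeierstrassCurve ℚ) [W.IsElliptic] [W.IsGloballyMinimal], IsOrdinaryAt W 2 →
      (∀ x : ℚ, ¬ HasRationalTwoTorsionX W x) →
      ∀ (κ : ZpExtension ℚ 2) (γ : Field.absoluteGaloisGroup ℚ), κ.IsCyclotomic →
      κ.IsTopGenerator γ → IsCyclotomicVariable 2 γ →
      ∀ ⦃N : ℕ⦄ [NeZero N] (f : CuspForm (Gamma0 N) 2), IsNewformOf W f →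
      ∀ Gp : IwasawaAlgebra 2, iwasawaToPowerSeries 2 Gp = padicLFunction f (unitRoot W 2 : ℚ_[2]) →
      ∀ (D : W.SelmerDualData κ γ) (Yr : W.FineSelmerDualDataRelaxedInf κ γ),
        ∃ (P X' Y' Xr : Type) (_ : AddCommGroup P) (_ : _root_.Module (IwasawaAlgebra 2) P)
          (_ : AddCommGroup X') (_ : _root_.Module (IwasawaAlgebra 2) X')
          (_ : AddCommGroup Y') (_ : _root_.Module (IwasawaAlgebra 2) Y')
          (_ : AddCommGroup Xr) (_ : _root_.Module (IwasawaAlgebra 2) Xr)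
          (toX : P →ₗ[IwasawaAlgebra 2] X') (π : X' →ₗ[IwasawaAlgebra 2] Y')
          (cP : P →ₗ[IwasawaAlgebra 2] P) (cX : X' →ₗ[IwasawaAlgebra 2] X')
          (cY : Y' →ₗ[IwasawaAlgebra 2] Y')
          (col : P →ₗ[IwasawaAlgebra 2] IwasawaAlgebra 2 × IwasawaAlgebra 2) (w₁ w₂ : P)
          (a b s : IwasawaAlgebra 2) (e : ℕ) (fd : (X' ⧸ LinearMap.range (cX - 1)) →ₗ[IwasawaAlgebra 2] Xr)
          (q : Xr →ₗ[IwasawaAlgebra 2] D.X)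
          (fyr : (Y' ⧸ LinearMap.range (cY - 1)) →ₗ[IwasawaAlgebra 2] Yr.X),
          Function.Exact toX π ∧ Function.Surjective π ∧ toX ∘ₗ cP = cX ∘ₗ toX ∧ π ∘ₗ cX = cY ∘ₗ π ∧
          Function.Injective col ∧
          col ∘ₗ cP = (LinearEquiv.prodComm (IwasawaAlgebra 2) (IwasawaAlgebra 2) (IwasawaAlgebra 2) :
            IwasawaAlgebra 2 × IwasawaAlgebra 2 →ₗ[IwasawaAlgebra 2]
              IwasawaAlgebra 2 × IwasawaAlgebra 2) ∘ₗ col ∧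
          Finite ((IwasawaAlgebra 2 × IwasawaAlgebra 2) ⧸ LinearMap.range col) ∧
          toX w₁ = 0 ∧ toX w₂ = 0 ∧ col w₁ = (a, b) ∧ col w₂ = (b, a) ∧
          s ∉ IwasawaAlgebra.augIdealP 2 ∧ a + b = PowerSeries.C ((2 : ℤ_[2]) ^ e) * s * Gp ∧
          Finite (Xr ⧸ LinearMap.range fd) ∧ Function.Surjective q ∧
          (e : ℕ∞) ≤ lengthAt (IwasawaAlgebra 2) (LinearMap.ker q)
              ⟨IwasawaAlgebra.augIdealP 2, IwasawaAlgebra.isPrime_augIdealP_holds 2⟩ ∧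
          lengthAt (IwasawaAlgebra 2) (LinearMap.ker fyr)
              ⟨IwasawaAlgebra.augIdealP 2, IwasawaAlgebra.isPrime_augIdealP_holds 2⟩ = 0)
    (hμ : ∀ (W : WeierstrassCurve ℚ) [W.IsElliptic] [W.IsGloballyMinimal], ¬ W.HasCM →
      IsOrdinaryAt W 2 → (∀ x : ℚ, ¬ HasRationalTwoTorsionX W x) → ¬ IsSquare W.Δ →
      W.analyticRank = 0 → BSDp W 2 →
      ∀ i : AlgebraicClosure ℚ, i ^ 2 = -1 →
      ∀ κL : ZpExtension ↥(W.divisionField 2 ⊔ IntermediateField.adjoin ℚ {i}) 2,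
        κL.IsCyclotomic → ClassicalMuVanishes κL) :
    MainConjectureOfRankZeroBSDAtTwo :=
  AlignedTransportAtTwoSeed.mainConjectureOfRankZeroBSDAtTwo_of_seedMuZero h17 hGr hper hmod hGZK
    (seedMuZeroAtTwo_of_fineRoadNettingRel hmod hLr hK2nr hμ)

end Glue

end Summit.BirchSwinnertonDyer.BirchSwinnertonDyer.Theorems.AlignedTransportAtTwoFineRoad

end
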